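import Mathlib
import HarnessLib
import Summits.ResolutionOfSingularities.ResolutionOfSingularities.Theorems.WildQuotientsWildQuotientResolutionS1aTriangularShiftKillsIn

/-!
# S1a — THE ONE-SHOT CENSUS: trA, k2a, a1c2, d4c3 are killed by ONE weighted move with shift (every prime `p`)

[OURS · L1 W4.5c · lead-1 g14; corollaries of `triangularShift_killsIn_one` (`…S1aTriangularShiftKillsIn`); plan-1 RULING R-F15g (3) / R-F15h (b) menu I-5b a1c2,
I-5d trA, I-5e d4c3 — delivered as ONE-SHOT root kills instead of the X-CERT 2–3-move trees (engine artefact: `wmax = 2`, `δ ≤ 1`)] — NOT statements of the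
manuscript; counted 0; AI-level work, weaker than expert review. Crux stmt-ResolutionOfSingularities-17941 `CyclicQuotientFourfolds`, line `s1a-logminvertex` v13
(`stub_reachLowerInFX`). RUNGS of the research stub, not the stub.

* ★ `trA_killsIn_one` (σ: x₁↦x₁+x₀², x₂↦x₂+x₀³, x₃↦x₃+x₂; centre (x₀:2, x₂:3), δ = 3) + `exists_reachLowerF_initial_of_trA` (I-5d);
* ★ `k2a_killsIn_one` (σ: x₁↦x₁+x₀, x₃↦x₃+x₁(x₁+x₀); centre (x₀:3, x₁:1), δ = 2);
* ★ `a1c2_killsIn_one` (σ: x₁↦x₁+x₀, x₂↦x₂+x₀, x₃↦x₃+x₁(x₁+x₀); same centre) + `exists_reachLowerF_initial_of_a1c2` (I-5b);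
* ★ `d4c3z_killsIn_one` (z-coordinates) and ★ `d4c3_killsIn_one` (printed coordinates x₃↦x₃+(x₁−x₂)³, via the recoordination x₁ ↦ x₁ − x₂ absorbed into `e`)
  + `exists_reachLowerF_initial_of_d4c3` (I-5e).
With J₄ (I-1), a1 (I-2), D₄ (I-3), j22 (I-5a), j3 (I-5c), sm, the transvection and ALL linear actions (I-6), every germ of X-CERT v1/v1.3-SMALLP except a1/D₄ is now a
ONE-SHOT kill on the frame; a1 and D₄ (reducible fixed locus) are the genuine multi-shot instances (✓p687171, ✓p699188).
-/

set_option linter.dupNamespace false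

noncomputable section

open CategoryTheory Limits AlgebraicGeometry TopologicalSpace Topology Opposite MvPolynomial
open Literature.AlgebraicGeometry.Resolution Literature.AlgebraicGeometry.RelativeSpec
open Summit.ResolutionOfSingularities.ResolutionOfSingularities.Theorems.WildQuotientResolution.S1
open Summit.ResolutionOfSingularities.ResolutionOfSingularities.Theorems.WildQuotientResolution.S1.NodeAtlas
open Summit.ResolutionOfSingularities.ResolutionOfSingularities.Theorems.WildQuotientResolution.S1.KillCert
open Summit.ResolutionOfSingularities.ResolutionOfSingularities.Theorems.WildQuotientResolution.S1.GoodCharts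
open Summit.ResolutionOfSingularities.ResolutionOfSingularities.Theorems.WildQuotientResolution.S1.NpFrame

namespace Summit.ResolutionOfSingularities.ResolutionOfSingularities.Theorems.WildQuotientResolution.S1.GameFrame.GModel

open KillCert

variable {p : ℕ} {X' X₁ : Scheme.{0}} {q : X' ⟶ X₁} {G : Type} [Group G] {ρ : G →* Aut X'} {g₀ : G}

/-! ## The census germs trA, k2a, a1c2, d4c3 are ONE-SHOT root kills -/

/-- ★ **trA is a one-shot kill** (σ: x₁ ↦ x₁+x₀², x₂ ↦ x₂+x₀³, x₃ ↦ x₃+x₂; X-CERT «depth 2»): centre (x₀:2, x₂:3), δ = 3, power chains `x₀³ = σx₂ − x₂` (m = 3),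
`x₂ = σx₃ − x₃`. Every `p` (datum inhabited for p = 3). [OURS · L1 W4.5c · I-5d as a ONE-SHOT; NOT a statement of the manuscript] -/
theorem trA_killsIn_one [Finite G] (hp : p.Prime) (hG : ∀ g : G, g ∈ Subgroup.zpowers g₀) (hg₀ : g₀ ^ p = 1)
    (hq : ∀ g : G, (ρ g).hom ≫ q = q) [IsIntegral X'] [IsLocallyNoetherian X'] [X'.IsSeparated] [IsAffine X'] [X₁.IsSeparated] [IsFinite q]
    (hreg : Scheme.IsRegular X') {k' : Type} [Field k'] (φ : X₁ ⟶ Spec (.of k')) [LocallyOfFiniteType φ]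
    {k : Type} [Field k] (σ : MvPolynomial (Fin 4) k ≃+* MvPolynomial (Fin 4) k) (hC : ∀ a : k, σ (C a) = C a)
    (h0 : σ (X 0) = X 0) (h1 : σ (X 1) = X 1 + X 0 ^ 2) (h2 : σ (X 2) = X 2 + X 0 ^ 3) (h3 : σ (X 3) = X 3 + X 2)
    (e : Γ(X', ⊤) ≃+* MvPolynomial (Fin 4) k)
    (hστ : ∀ t : Γ(X', ⊤), e ((ρ g₀⁻¹).hom.appLE ⊤ ⊤ (by rw [Scheme.Hom.preimage_top]) t) = σ (e t))
    (h₀ : NodeAtlas p (⟨ρ, hq⟩ : ActionOver q G) g₀) :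
    KillsIn 1 (GModel.initial (p := p) (g₀ := g₀) hq h₀) := by
  let v : Fin 2 → Fin 4 := ![0, 2]
  let w : Fin 2 → ℕ := ![2, 3]
  have hv : Function.Injective v := by decide
  have hX0 : (X 0 : MvPolynomial (Fin 4) k) ∈ (weightedFiltration (X ∘ v : Fin 2 → MvPolynomial (Fin 4) k) w).ideal 2 :=
    mem_weightedFiltration_ideal (X ∘ v : Fin 2 → MvPolynomial (Fin 4) k) w 0
  have hX2 : (X 2 : MvPolynomial (Fin 4) k) ∈ (weightedFiltration (X ∘ v : Fin 2 → MvPolynomial (Fin 4) k) w).ideal 3 :=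
    mem_weightedFiltration_ideal (X ∘ v : Fin 2 → MvPolynomial (Fin 4) k) w 1
  have hX0sq : (X 0 : MvPolynomial (Fin 4) k) ^ 2 ∈ (weightedFiltration (X ∘ v : Fin 2 → MvPolynomial (Fin 4) k) w).ideal 4 :=
    pow_mem_weightedFiltration_ideal (X ∘ v : Fin 2 → MvPolynomial (Fin 4) k) w 0 2
  have hX0cb : (X 0 : MvPolynomial (Fin 4) k) ^ 3 ∈ (weightedFiltration (X ∘ v : Fin 2 → MvPolynomial (Fin 4) k) w).ideal 6 :=
    pow_mem_weightedFiltration_ideal (X ∘ v : Fin 2 → MvPolynomial (Fin 4) k) w 0 3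
  have hinc0 : σ (X 0) - X 0 = 0 := by rw [h0, sub_self]
  have hinc1 : σ (X 1) - X 1 = X 0 ^ 2 := by rw [h1]; ring
  have hinc2 : σ (X 2) - X 2 = X 0 ^ 3 := by rw [h2]; ring
  have hinc3 : σ (X 3) - X 3 = X 2 := by rw [h3]; ring
  refine triangularShift_killsIn_one hp hG hg₀ hq hreg φ σ hC (by norm_num : 0 < 2) v hv w (fun l => by fin_cases l <;> decide) 3 ?_ ?_ ?_ ?_ e hστ h₀
  · intro i
    fin_cases i
    · change σ (X 0) - X 0 ∈ _; rw [hinc0]; exact Ideal.zero_mem _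
    · change σ (X 1) - X 1 ∈ _; rw [hinc1]; exact (weightedFiltration _ w).antitone (by norm_num : 3 ≤ 4) hX0sq
    · change σ (X 2) - X 2 ∈ _; rw [hinc2]; exact (weightedFiltration _ w).antitone (by norm_num : 3 ≤ 6) hX0cb
    · change σ (X 3) - X 3 ∈ _; rw [hinc3]; exact hX2
  · intro l
    fin_cases l
    · change σ (X 0) - X 0 ∈ _; rw [hinc0]; exact Ideal.zero_mem _
    · change σ (X 2) - X 2 ∈ (weightedFiltration (X ∘ v : Fin 2 → MvPolynomial (Fin 4) k) w).ideal 6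
      rw [hinc2]; exact hX0cb
  · refine exists_span_pow_le_of_pow_mem _ _ fun l => ?_
    fin_cases l
    · refine ⟨2, ?_⟩; change (X 0 : MvPolynomial (Fin 4) k) ^ 2 ∈ _
      rw [← hinc1]; exact sub_mem_augmentationIdeal σ _
    · refine ⟨1, ?_⟩; change (X 2 : MvPolynomial (Fin 4) k) ^ 1 ∈ _
      rw [pow_one, ← hinc3]; exact sub_mem_augmentationIdeal σ _
  · intro l
    fin_cases l
    · refine ⟨3, X 2, 1, by norm_num, by decide, isUnit_one, ?_, ?_⟩
      · change (X 2 : MvPolynomial (Fin 4) k) ∈ (weightedFiltration (X ∘ v : Fin 2 → MvPolynomial (Fin 4) k) w).ideal 3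
        exact hX2
      · change σ (X 2) - X 2 - 1 * X 0 ^ 3 ∈ _
        have e0 : σ (X 2) - X 2 - 1 * X 0 ^ 3 = 0 := by rw [hinc2]; ring
        rw [e0]; exact Ideal.zero_mem _
    · refine ⟨1, X 3, 1, one_pos, by decide, isUnit_one, ?_, ?_⟩
      · change (X 3 : MvPolynomial (Fin 4) k) ∈ (weightedFiltration (X ∘ v : Fin 2 → MvPolynomial (Fin 4) k) w).ideal 0
        exact mem_weightedFiltration_zero _ w _
      · change σ (X 3) - X 3 - 1 * X 2 ^ 1 ∈ _
        have e0 : σ (X 3) - X 3 - 1 * X 2 ^ 1 = 0 := by rw [hinc3]; ring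
        rw [e0]; exact Ideal.zero_mem _

/-- ★ **k2a is a one-shot kill** (σ: x₁ ↦ x₁+x₀, x₃ ↦ x₃+x₁(x₁+x₀), x₀, x₂ fixed; X-CERT «depth 2», p = 2 datum): centre (x₀:3, x₁:1), δ = 2, power chains
`x₀ = σx₁ − x₁`, `x₁² ≡ σx₃ − x₃ mod 𝒥₃` (m = 2). Every `p`. [OURS · L1 W4.5c · one-shot class with shift; NOT a statement of the manuscript] -/
theorem k2a_killsIn_one [Finite G] (hp : p.Prime) (hG : ∀ g : G, g ∈ Subgroup.zpowers g₀) (hg₀ : g₀ ^ p = 1)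
    (hq : ∀ g : G, (ρ g).hom ≫ q = q) [IsIntegral X'] [IsLocallyNoetherian X'] [X'.IsSeparated] [IsAffine X'] [X₁.IsSeparated] [IsFinite q]
    (hreg : Scheme.IsRegular X') {k' : Type} [Field k'] (φ : X₁ ⟶ Spec (.of k')) [LocallyOfFiniteType φ]
    {k : Type} [Field k] (σ : MvPolynomial (Fin 4) k ≃+* MvPolynomial (Fin 4) k) (hC : ∀ a : k, σ (C a) = C a)
    (h0 : σ (X 0) = X 0) (h1 : σ (X 1) = X 1 + X 0) (h2 : σ (X 2) = X 2) (h3 : σ (X 3) = X 3 + X 1 * (X 1 + X 0))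
    (e : Γ(X', ⊤) ≃+* MvPolynomial (Fin 4) k)
    (hστ : ∀ t : Γ(X', ⊤), e ((ρ g₀⁻¹).hom.appLE ⊤ ⊤ (by rw [Scheme.Hom.preimage_top]) t) = σ (e t))
    (h₀ : NodeAtlas p (⟨ρ, hq⟩ : ActionOver q G) g₀) :
    KillsIn 1 (GModel.initial (p := p) (g₀ := g₀) hq h₀) := by
  let v : Fin 2 → Fin 4 := ![0, 1]
  let w : Fin 2 → ℕ := ![3, 1]
  have hv : Function.Injective v := by decide
  have hX0 : (X 0 : MvPolynomial (Fin 4) k) ∈ (weightedFiltration (X ∘ v : Fin 2 → MvPolynomial (Fin 4) k) w).ideal 3 :=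
    mem_weightedFiltration_ideal (X ∘ v : Fin 2 → MvPolynomial (Fin 4) k) w 0
  have hX1 : (X 1 : MvPolynomial (Fin 4) k) ∈ (weightedFiltration (X ∘ v : Fin 2 → MvPolynomial (Fin 4) k) w).ideal 1 :=
    mem_weightedFiltration_ideal (X ∘ v : Fin 2 → MvPolynomial (Fin 4) k) w 1
  have hX1sq : (X 1 : MvPolynomial (Fin 4) k) * X 1 ∈ (weightedFiltration (X ∘ v : Fin 2 → MvPolynomial (Fin 4) k) w).ideal 2 :=
    (weightedFiltration _ w).mul_le 1 1 (Ideal.mul_mem_mul hX1 hX1)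
  have hX1X0 : (X 1 : MvPolynomial (Fin 4) k) * X 0 ∈ (weightedFiltration (X ∘ v : Fin 2 → MvPolynomial (Fin 4) k) w).ideal 4 :=
    (weightedFiltration _ w).mul_le 1 3 (Ideal.mul_mem_mul hX1 hX0)
  have hinc0 : σ (X 0) - X 0 = 0 := by rw [h0, sub_self]
  have hinc1 : σ (X 1) - X 1 = X 0 := by rw [h1]; ring
  have hinc2 : σ (X 2) - X 2 = 0 := by rw [h2, sub_self]
  have hinc3 : σ (X 3) - X 3 = X 1 * X 1 + X 1 * X 0 := by rw [h3]; ring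
  refine triangularShift_killsIn_one hp hG hg₀ hq hreg φ σ hC (by norm_num : 0 < 2) v hv w (fun l => by fin_cases l <;> decide) 2 ?_ ?_ ?_ ?_ e hστ h₀
  · intro i
    fin_cases i
    · change σ (X 0) - X 0 ∈ _; rw [hinc0]; exact Ideal.zero_mem _
    · change σ (X 1) - X 1 ∈ _; rw [hinc1]; exact (weightedFiltration _ w).antitone (by norm_num : 2 ≤ 3) hX0
    · change σ (X 2) - X 2 ∈ _; rw [hinc2]; exact Ideal.zero_mem _
    · change σ (X 3) - X 3 ∈ _; rw [hinc3]; exact add_mem hX1sq ((weightedFiltration _ w).antitone (by norm_num : 2 ≤ 4) hX1X0)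
  · intro l
    fin_cases l
    · change σ (X 0) - X 0 ∈ _; rw [hinc0]; exact Ideal.zero_mem _
    · change σ (X 1) - X 1 ∈ (weightedFiltration (X ∘ v : Fin 2 → MvPolynomial (Fin 4) k) w).ideal 3
      rw [hinc1]; exact hX0
  · refine exists_span_pow_le_of_pow_mem _ _ fun l => ?_
    fin_cases l
    · refine ⟨1, ?_⟩; change (X 0 : MvPolynomial (Fin 4) k) ^ 1 ∈ _
      rw [pow_one, ← hinc1]; exact sub_mem_augmentationIdeal σ _
    · refine ⟨2, ?_⟩; change (X 1 : MvPolynomial (Fin 4) k) ^ 2 ∈ _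
      have e1 : (X 1 : MvPolynomial (Fin 4) k) ^ 2 = (σ (X 3) - X 3) - X 1 * (σ (X 1) - X 1) := by rw [hinc3, hinc1]; ring
      rw [e1]
      exact sub_mem (sub_mem_augmentationIdeal σ _) (Ideal.mul_mem_left _ _ (sub_mem_augmentationIdeal σ _))
  · intro l
    fin_cases l
    · refine ⟨1, X 1, 1, one_pos, by decide, isUnit_one, ?_, ?_⟩
      · change (X 1 : MvPolynomial (Fin 4) k) ∈ (weightedFiltration (X ∘ v : Fin 2 → MvPolynomial (Fin 4) k) w).ideal 1
        exact hX1
      · change σ (X 1) - X 1 - 1 * X 0 ^ 1 ∈ _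
        have e0 : σ (X 1) - X 1 - 1 * X 0 ^ 1 = 0 := by rw [hinc1]; ring
        rw [e0]; exact Ideal.zero_mem _
    · refine ⟨2, X 3, 1, two_pos, by decide, isUnit_one, ?_, ?_⟩
      · change (X 3 : MvPolynomial (Fin 4) k) ∈ (weightedFiltration (X ∘ v : Fin 2 → MvPolynomial (Fin 4) k) w).ideal 0
        exact mem_weightedFiltration_zero _ w _
      · change σ (X 3) - X 3 - 1 * X 1 ^ 2 ∈ (weightedFiltration (X ∘ v : Fin 2 → MvPolynomial (Fin 4) k) w).ideal 3
        have e1 : σ (X 3) - X 3 - 1 * X 1 ^ 2 = X 1 * X 0 := by rw [hinc3]; ring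
        rw [e1]; exact (weightedFiltration _ w).antitone (by norm_num : 3 ≤ 4) hX1X0

/-- ★ **a1c2 is a one-shot kill** (σ: x₁ ↦ x₁+x₀, x₂ ↦ x₂+x₀, x₃ ↦ x₃+x₁²+x₀x₁; X-CERT «depth 2, first norm-unit kill», p = 2 datum): centre (x₀:3, x₁:1), δ = 2,
as k2a. Every `p`. [OURS · L1 W4.5c · I-5b as a ONE-SHOT; NOT a statement of the manuscript] -/
theorem a1c2_killsIn_one [Finite G] (hp : p.Prime) (hG : ∀ g : G, g ∈ Subgroup.zpowers g₀) (hg₀ : g₀ ^ p = 1)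
    (hq : ∀ g : G, (ρ g).hom ≫ q = q) [IsIntegral X'] [IsLocallyNoetherian X'] [X'.IsSeparated] [IsAffine X'] [X₁.IsSeparated] [IsFinite q]
    (hreg : Scheme.IsRegular X') {k' : Type} [Field k'] (φ : X₁ ⟶ Spec (.of k')) [LocallyOfFiniteType φ]
    {k : Type} [Field k] (σ : MvPolynomial (Fin 4) k ≃+* MvPolynomial (Fin 4) k) (hC : ∀ a : k, σ (C a) = C a)
    (h0 : σ (X 0) = X 0) (h1 : σ (X 1) = X 1 + X 0) (h2 : σ (X 2) = X 2 + X 0) (h3 : σ (X 3) = X 3 + X 1 * (X 1 + X 0))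
    (e : Γ(X', ⊤) ≃+* MvPolynomial (Fin 4) k)
    (hστ : ∀ t : Γ(X', ⊤), e ((ρ g₀⁻¹).hom.appLE ⊤ ⊤ (by rw [Scheme.Hom.preimage_top]) t) = σ (e t))
    (h₀ : NodeAtlas p (⟨ρ, hq⟩ : ActionOver q G) g₀) :
    KillsIn 1 (GModel.initial (p := p) (g₀ := g₀) hq h₀) := by
  let v : Fin 2 → Fin 4 := ![0, 1]
  let w : Fin 2 → ℕ := ![3, 1]
  have hv : Function.Injective v := by decide
  have hX0 : (X 0 : MvPolynomial (Fin 4) k) ∈ (weightedFiltration (X ∘ v : Fin 2 → MvPolynomial (Fin 4) k) w).ideal 3 :=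
    mem_weightedFiltration_ideal (X ∘ v : Fin 2 → MvPolynomial (Fin 4) k) w 0
  have hX1 : (X 1 : MvPolynomial (Fin 4) k) ∈ (weightedFiltration (X ∘ v : Fin 2 → MvPolynomial (Fin 4) k) w).ideal 1 :=
    mem_weightedFiltration_ideal (X ∘ v : Fin 2 → MvPolynomial (Fin 4) k) w 1
  have hX1sq : (X 1 : MvPolynomial (Fin 4) k) * X 1 ∈ (weightedFiltration (X ∘ v : Fin 2 → MvPolynomial (Fin 4) k) w).ideal 2 :=
    (weightedFiltration _ w).mul_le 1 1 (Ideal.mul_mem_mul hX1 hX1)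
  have hX1X0 : (X 1 : MvPolynomial (Fin 4) k) * X 0 ∈ (weightedFiltration (X ∘ v : Fin 2 → MvPolynomial (Fin 4) k) w).ideal 4 :=
    (weightedFiltration _ w).mul_le 1 3 (Ideal.mul_mem_mul hX1 hX0)
  have hinc0 : σ (X 0) - X 0 = 0 := by rw [h0, sub_self]
  have hinc1 : σ (X 1) - X 1 = X 0 := by rw [h1]; ring
  have hinc2 : σ (X 2) - X 2 = X 0 := by rw [h2]; ring
  have hinc3 : σ (X 3) - X 3 = X 1 * X 1 + X 1 * X 0 := by rw [h3]; ring
  refine triangularShift_killsIn_one hp hG hg₀ hq hreg φ σ hC (by norm_num : 0 < 2) v hv w (fun l => by fin_cases l <;> decide) 2 ?_ ?_ ?_ ?_ e hστ h₀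
  · intro i
    fin_cases i
    · change σ (X 0) - X 0 ∈ _; rw [hinc0]; exact Ideal.zero_mem _
    · change σ (X 1) - X 1 ∈ _; rw [hinc1]; exact (weightedFiltration _ w).antitone (by norm_num : 2 ≤ 3) hX0
    · change σ (X 2) - X 2 ∈ _; rw [hinc2]; exact (weightedFiltration _ w).antitone (by norm_num : 2 ≤ 3) hX0
    · change σ (X 3) - X 3 ∈ _; rw [hinc3]; exact add_mem hX1sq ((weightedFiltration _ w).antitone (by norm_num : 2 ≤ 4) hX1X0)
  · intro l
    fin_cases l
    · change σ (X 0) - X 0 ∈ _; rw [hinc0]; exact Ideal.zero_mem _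
    · change σ (X 1) - X 1 ∈ (weightedFiltration (X ∘ v : Fin 2 → MvPolynomial (Fin 4) k) w).ideal 3
      rw [hinc1]; exact hX0
  · refine exists_span_pow_le_of_pow_mem _ _ fun l => ?_
    fin_cases l
    · refine ⟨1, ?_⟩; change (X 0 : MvPolynomial (Fin 4) k) ^ 1 ∈ _
      rw [pow_one, ← hinc1]; exact sub_mem_augmentationIdeal σ _
    · refine ⟨2, ?_⟩; change (X 1 : MvPolynomial (Fin 4) k) ^ 2 ∈ _
      have e1 : (X 1 : MvPolynomial (Fin 4) k) ^ 2 = (σ (X 3) - X 3) - X 1 * (σ (X 1) - X 1) := by rw [hinc3, hinc1]; ring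
      rw [e1]
      exact sub_mem (sub_mem_augmentationIdeal σ _) (Ideal.mul_mem_left _ _ (sub_mem_augmentationIdeal σ _))
  · intro l
    fin_cases l
    · refine ⟨1, X 1, 1, one_pos, by decide, isUnit_one, ?_, ?_⟩
      · change (X 1 : MvPolynomial (Fin 4) k) ∈ (weightedFiltration (X ∘ v : Fin 2 → MvPolynomial (Fin 4) k) w).ideal 1
        exact hX1
      · change σ (X 1) - X 1 - 1 * X 0 ^ 1 ∈ _
        have e0 : σ (X 1) - X 1 - 1 * X 0 ^ 1 = 0 := by rw [hinc1]; ring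
        rw [e0]; exact Ideal.zero_mem _
    · refine ⟨2, X 3, 1, two_pos, by decide, isUnit_one, ?_, ?_⟩
      · change (X 3 : MvPolynomial (Fin 4) k) ∈ (weightedFiltration (X ∘ v : Fin 2 → MvPolynomial (Fin 4) k) w).ideal 0
        exact mem_weightedFiltration_zero _ w _
      · change σ (X 3) - X 3 - 1 * X 1 ^ 2 ∈ (weightedFiltration (X ∘ v : Fin 2 → MvPolynomial (Fin 4) k) w).ideal 3
        have e1 : σ (X 3) - X 3 - 1 * X 1 ^ 2 = X 1 * X 0 := by rw [hinc3]; ring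
        rw [e1]; exact (weightedFiltration _ w).antitone (by norm_num : 3 ≤ 4) hX1X0

/-- ★ **d4c3 in the coordinates `z = x₁ − x₂` is a one-shot kill** (σ: x₀, z fixed, x₂ ↦ x₂+x₀, x₃ ↦ x₃+z³ — here `z` is the variable `X 1`; X-CERT «depth 3»,
p = 3 datum): centre (x₀:3, z:1), δ = 3, power chains `x₀ = σx₂ − x₂`, `z³ = σx₃ − x₃` (m = 3). Every `p`. [OURS · L1 W4.5c · I-5e as a ONE-SHOT] -/
theorem d4c3z_killsIn_one [Finite G] (hp : p.Prime) (hG : ∀ g : G, g ∈ Subgroup.zpowers g₀) (hg₀ : g₀ ^ p = 1)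
    (hq : ∀ g : G, (ρ g).hom ≫ q = q) [IsIntegral X'] [IsLocallyNoetherian X'] [X'.IsSeparated] [IsAffine X'] [X₁.IsSeparated] [IsFinite q]
    (hreg : Scheme.IsRegular X') {k' : Type} [Field k'] (φ : X₁ ⟶ Spec (.of k')) [LocallyOfFiniteType φ]
    {k : Type} [Field k] (σ : MvPolynomial (Fin 4) k ≃+* MvPolynomial (Fin 4) k) (hC : ∀ a : k, σ (C a) = C a)
    (h0 : σ (X 0) = X 0) (h1 : σ (X 1) = X 1) (h2 : σ (X 2) = X 2 + X 0) (h3 : σ (X 3) = X 3 + X 1 ^ 3)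
    (e : Γ(X', ⊤) ≃+* MvPolynomial (Fin 4) k)
    (hστ : ∀ t : Γ(X', ⊤), e ((ρ g₀⁻¹).hom.appLE ⊤ ⊤ (by rw [Scheme.Hom.preimage_top]) t) = σ (e t))
    (h₀ : NodeAtlas p (⟨ρ, hq⟩ : ActionOver q G) g₀) :
    KillsIn 1 (GModel.initial (p := p) (g₀ := g₀) hq h₀) := by
  let v : Fin 2 → Fin 4 := ![0, 1]
  let w : Fin 2 → ℕ := ![3, 1]
  have hv : Function.Injective v := by decide
  have hX0 : (X 0 : MvPolynomial (Fin 4) k) ∈ (weightedFiltration (X ∘ v : Fin 2 → MvPolynomial (Fin 4) k) w).ideal 3 :=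
    mem_weightedFiltration_ideal (X ∘ v : Fin 2 → MvPolynomial (Fin 4) k) w 0
  have hX1cb : (X 1 : MvPolynomial (Fin 4) k) ^ 3 ∈ (weightedFiltration (X ∘ v : Fin 2 → MvPolynomial (Fin 4) k) w).ideal 3 :=
    pow_mem_weightedFiltration_ideal (X ∘ v : Fin 2 → MvPolynomial (Fin 4) k) w 1 3
  have hinc0 : σ (X 0) - X 0 = 0 := by rw [h0, sub_self]
  have hinc1 : σ (X 1) - X 1 = 0 := by rw [h1, sub_self]
  have hinc2 : σ (X 2) - X 2 = X 0 := by rw [h2]; ring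
  have hinc3 : σ (X 3) - X 3 = X 1 ^ 3 := by rw [h3]; ring
  refine triangularShift_killsIn_one hp hG hg₀ hq hreg φ σ hC (by norm_num : 0 < 2) v hv w (fun l => by fin_cases l <;> decide) 3 ?_ ?_ ?_ ?_ e hστ h₀
  · intro i
    fin_cases i
    · change σ (X 0) - X 0 ∈ _; rw [hinc0]; exact Ideal.zero_mem _
    · change σ (X 1) - X 1 ∈ _; rw [hinc1]; exact Ideal.zero_mem _
    · change σ (X 2) - X 2 ∈ _; rw [hinc2]; exact hX0
    · change σ (X 3) - X 3 ∈ _; rw [hinc3]; exact hX1cb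
  · intro l
    fin_cases l
    · change σ (X 0) - X 0 ∈ _; rw [hinc0]; exact Ideal.zero_mem _
    · change σ (X 1) - X 1 ∈ _; rw [hinc1]; exact Ideal.zero_mem _
  · refine exists_span_pow_le_of_pow_mem _ _ fun l => ?_
    fin_cases l
    · refine ⟨1, ?_⟩; change (X 0 : MvPolynomial (Fin 4) k) ^ 1 ∈ _
      rw [pow_one, ← hinc2]; exact sub_mem_augmentationIdeal σ _
    · refine ⟨3, ?_⟩; change (X 1 : MvPolynomial (Fin 4) k) ^ 3 ∈ _
      rw [← hinc3]; exact sub_mem_augmentationIdeal σ _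
  · intro l
    fin_cases l
    · refine ⟨1, X 2, 1, one_pos, by decide, isUnit_one, ?_, ?_⟩
      · change (X 2 : MvPolynomial (Fin 4) k) ∈ (weightedFiltration (X ∘ v : Fin 2 → MvPolynomial (Fin 4) k) w).ideal 0
        exact mem_weightedFiltration_zero _ w _
      · change σ (X 2) - X 2 - 1 * X 0 ^ 1 ∈ _
        have e0 : σ (X 2) - X 2 - 1 * X 0 ^ 1 = 0 := by rw [hinc2]; ring
        rw [e0]; exact Ideal.zero_mem _
    · refine ⟨3, X 3, 1, by norm_num, by decide, isUnit_one, ?_, ?_⟩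
      · change (X 3 : MvPolynomial (Fin 4) k) ∈ (weightedFiltration (X ∘ v : Fin 2 → MvPolynomial (Fin 4) k) w).ideal 0
        exact mem_weightedFiltration_zero _ w _
      · change σ (X 3) - X 3 - 1 * X 1 ^ 3 ∈ _
        have e0 : σ (X 3) - X 3 - 1 * X 1 ^ 3 = 0 := by rw [hinc3]; ring
        rw [e0]; exact Ideal.zero_mem _

/-- ★ **d4c3 in the printed coordinates is a one-shot kill** (σ: x₁ ↦ x₁+x₀, x₂ ↦ x₂+x₀, x₃ ↦ x₃+(x₁−x₂)³): the linear recoordination `x₁ ↦ x₁ − x₂` (an algebra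
automorphism `α` of `k[x]`, absorbed into `e`) conjugates σ to the `z`-form of `d4c3z_killsIn_one`. [OURS · L1 W4.5c · I-5e as a ONE-SHOT; NOT a statement of the
manuscript] -/
theorem d4c3_killsIn_one [Finite G] (hp : p.Prime) (hG : ∀ g : G, g ∈ Subgroup.zpowers g₀) (hg₀ : g₀ ^ p = 1)
    (hq : ∀ g : G, (ρ g).hom ≫ q = q) [IsIntegral X'] [IsLocallyNoetherian X'] [X'.IsSeparated] [IsAffine X'] [X₁.IsSeparated] [IsFinite q]
    (hreg : Scheme.IsRegular X') {k' : Type} [Field k'] (φ : X₁ ⟶ Spec (.of k')) [LocallyOfFiniteType φ]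
    {k : Type} [Field k] (σ : MvPolynomial (Fin 4) k ≃+* MvPolynomial (Fin 4) k) (hC : ∀ a : k, σ (C a) = C a)
    (h0 : σ (X 0) = X 0) (h1 : σ (X 1) = X 1 + X 0) (h2 : σ (X 2) = X 2 + X 0) (h3 : σ (X 3) = X 3 + (X 1 - X 2) ^ 3)
    (e : Γ(X', ⊤) ≃+* MvPolynomial (Fin 4) k)
    (hστ : ∀ t : Γ(X', ⊤), e ((ρ g₀⁻¹).hom.appLE ⊤ ⊤ (by rw [Scheme.Hom.preimage_top]) t) = σ (e t))
    (h₀ : NodeAtlas p (⟨ρ, hq⟩ : ActionOver q G) g₀) :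
    KillsIn 1 (GModel.initial (p := p) (g₀ := g₀) hq h₀) := by
  -- the recoordination `α : x₁ ↦ x₁ − x₂` and its inverse `x₁ ↦ x₁ + x₂`
  let φ₁ : MvPolynomial (Fin 4) k →ₐ[k] MvPolynomial (Fin 4) k := aeval ![X 0, X 1 - X 2, X 2, X 3]
  let ψ₁ : MvPolynomial (Fin 4) k →ₐ[k] MvPolynomial (Fin 4) k := aeval ![X 0, X 1 + X 2, X 2, X 3]
  have hφ0 : φ₁ (X 0) = X 0 := aeval_X _ 0
  have hφ1 : φ₁ (X 1) = X 1 - X 2 := aeval_X _ 1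
  have hφ2 : φ₁ (X 2) = X 2 := aeval_X _ 2
  have hφ3 : φ₁ (X 3) = X 3 := aeval_X _ 3
  have hψ0 : ψ₁ (X 0) = X 0 := aeval_X _ 0
  have hψ1 : ψ₁ (X 1) = X 1 + X 2 := aeval_X _ 1
  have hψ2 : ψ₁ (X 2) = X 2 := aeval_X _ 2
  have hψ3 : ψ₁ (X 3) = X 3 := aeval_X _ 3
  have hφψ : φ₁.comp ψ₁ = AlgHom.id k _ := algHom_ext fun i => by
    rw [AlgHom.comp_apply, AlgHom.id_apply]
    fin_cases i
    · change φ₁ (ψ₁ (X 0)) = X 0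
      rw [hψ0, hφ0]
    · change φ₁ (ψ₁ (X 1)) = X 1
      rw [hψ1, map_add, hφ1, hφ2]; ring
    · change φ₁ (ψ₁ (X 2)) = X 2
      rw [hψ2, hφ2]
    · change φ₁ (ψ₁ (X 3)) = X 3
      rw [hψ3, hφ3]
  have hψφ : ψ₁.comp φ₁ = AlgHom.id k _ := algHom_ext fun i => by
    rw [AlgHom.comp_apply, AlgHom.id_apply]
    fin_cases i
    · change ψ₁ (φ₁ (X 0)) = X 0
      rw [hφ0, hψ0]
    · change ψ₁ (φ₁ (X 1)) = X 1
      rw [hφ1, map_sub, hψ1, hψ2]; ring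
    · change ψ₁ (φ₁ (X 2)) = X 2
      rw [hφ2, hψ2]
    · change ψ₁ (φ₁ (X 3)) = X 3
      rw [hφ3, hψ3]
  let αA : MvPolynomial (Fin 4) k ≃ₐ[k] MvPolynomial (Fin 4) k := AlgEquiv.ofAlgHom φ₁ ψ₁ hφψ hψφ
  let α : MvPolynomial (Fin 4) k ≃+* MvPolynomial (Fin 4) k := αA.toRingEquiv
  have hαφ : ∀ y, α y = φ₁ y := fun _ => rfl
  have hαψ : ∀ y, α.symm y = ψ₁ y := fun _ => rfl
  -- the conjugate `σ' = α⁻¹ σ α` is the z-form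
  let σ' : MvPolynomial (Fin 4) k ≃+* MvPolynomial (Fin 4) k := α.trans (σ.trans α.symm)
  have hσ' : ∀ y, σ' y = α.symm (σ (α y)) := fun _ => rfl
  have hC' : ∀ a : k, σ' (C a) = C a := fun a => by
    have h1' : φ₁ (C a) = C a := φ₁.commutes a
    have h2' : ψ₁ (C a) = C a := ψ₁.commutes a
    rw [hσ', hαφ, h1', hC, hαψ, h2']
  have h0' : σ' (X 0) = X 0 := by rw [hσ', hαφ, hφ0, h0, hαψ, hψ0]
  have h1' : σ' (X 1) = X 1 := by
    rw [hσ', hαφ, hφ1, map_sub, h1, h2, hαψ]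
    have e1 : (X 1 + X 0 - (X 2 + X 0) : MvPolynomial (Fin 4) k) = X 1 - X 2 := by ring
    rw [e1, map_sub, hψ1, hψ2]; ring
  have h2' : σ' (X 2) = X 2 + X 0 := by rw [hσ', hαφ, hφ2, h2, hαψ, map_add, hψ2, hψ0]
  have h3' : σ' (X 3) = X 3 + X 1 ^ 3 := by
    rw [hσ', hαφ, hφ3, h3, hαψ, map_add, map_pow, map_sub, hψ3, hψ1, hψ2]; ring
  -- the new presentation `e' = α⁻¹ ∘ e` intertwines `g₀` with `σ'`
  let e' : Γ(X', ⊤) ≃+* MvPolynomial (Fin 4) k := e.trans α.symm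
  have hστ' : ∀ t : Γ(X', ⊤), e' ((ρ g₀⁻¹).hom.appLE ⊤ ⊤ (by rw [Scheme.Hom.preimage_top]) t) = σ' (e' t) := by
    intro t
    change α.symm (e _) = σ' (α.symm (e t))
    rw [hστ, hσ', α.apply_symm_apply]
  exact d4c3z_killsIn_one hp hG hg₀ hq hreg φ σ' hC' h0' h1' h2' h3' e' hστ' h₀

/-- **I-5d OF RECORD: the trA datum satisfies the conclusion of `ReachLowerInF(X)`** at its initial model with ANY root decoration `𝔄₀`
(`exists_reachLowerF_of_killsIn_datum` on `trA_killsIn_one`). [OURS · L1 W4.5c; NOT a statement of the manuscript] -/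
theorem exists_reachLowerF_initial_of_trA [Finite G] (hp : p.Prime) (hG : ∀ g : G, g ∈ Subgroup.zpowers g₀) (hg₀ : g₀ ^ p = 1)
    (hq : ∀ g : G, (ρ g).hom ≫ q = q) [IsIntegral X'] [IsLocallyNoetherian X'] [X'.IsSeparated] [IsAffine X'] [X₁.IsSeparated] [IsFinite q]
    (hreg : Scheme.IsRegular X') {k' : Type} [Field k'] (φ : X₁ ⟶ Spec (.of k')) [LocallyOfFiniteType φ]
    {k : Type} [Field k] (σ : MvPolynomial (Fin 4) k ≃+* MvPolynomial (Fin 4) k) (hC : ∀ a : k, σ (C a) = C a)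
    (h0 : σ (X 0) = X 0) (h1 : σ (X 1) = X 1 + X 0 ^ 2) (h2 : σ (X 2) = X 2 + X 0 ^ 3) (h3 : σ (X 3) = X 3 + X 2)
    (e : Γ(X', ⊤) ≃+* MvPolynomial (Fin 4) k)
    (hστ : ∀ t : Γ(X', ⊤), e ((ρ g₀⁻¹).hom.appLE ⊤ ⊤ (by rw [Scheme.Hom.preimage_top]) t) = σ (e t))
    (h₀ : NodeAtlas p (⟨ρ, hq⟩ : ActionOver q G) g₀) (𝔄₀ : NodeAtlasData p (GModel.initial hq h₀).act g₀) :
    ∃ P : ∀ M : GModel p q G ρ g₀, NodeAtlasData p M.act g₀ → Prop,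
      P (GModel.initial hq h₀) 𝔄₀ ∧ ∀ (M : GModel p q G ρ g₀) (𝔄 : NodeAtlasData p M.act g₀), P M 𝔄 → ¬ M.Terminal →
        ∃ n : ℕ, TreeF P (fun N 𝔅 => LexLTF N 𝔅 M 𝔄) n M 𝔄 :=
  exists_reachLowerF_of_killsIn_datum hp hG φ (GModel.initial hq h₀) 𝔄₀ (trA_killsIn_one hp hG hg₀ hq hreg φ σ hC h0 h1 h2 h3 e hστ h₀)

/-- **I-5b OF RECORD: the a1c2 datum satisfies the conclusion of `ReachLowerInF(X)`** at its initial model with ANY root decoration `𝔄₀`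
(`exists_reachLowerF_of_killsIn_datum` on `a1c2_killsIn_one`). [OURS · L1 W4.5c; NOT a statement of the manuscript] -/
theorem exists_reachLowerF_initial_of_a1c2 [Finite G] (hp : p.Prime) (hG : ∀ g : G, g ∈ Subgroup.zpowers g₀) (hg₀ : g₀ ^ p = 1)
    (hq : ∀ g : G, (ρ g).hom ≫ q = q) [IsIntegral X'] [IsLocallyNoetherian X'] [X'.IsSeparated] [IsAffine X'] [X₁.IsSeparated] [IsFinite q]
    (hreg : Scheme.IsRegular X') {k' : Type} [Field k'] (φ : X₁ ⟶ Spec (.of k')) [LocallyOfFiniteType φ]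
    {k : Type} [Field k] (σ : MvPolynomial (Fin 4) k ≃+* MvPolynomial (Fin 4) k) (hC : ∀ a : k, σ (C a) = C a)
    (h0 : σ (X 0) = X 0) (h1 : σ (X 1) = X 1 + X 0) (h2 : σ (X 2) = X 2 + X 0) (h3 : σ (X 3) = X 3 + X 1 * (X 1 + X 0))
    (e : Γ(X', ⊤) ≃+* MvPolynomial (Fin 4) k)
    (hστ : ∀ t : Γ(X', ⊤), e ((ρ g₀⁻¹).hom.appLE ⊤ ⊤ (by rw [Scheme.Hom.preimage_top]) t) = σ (e t))
    (h₀ : NodeAtlas p (⟨ρ, hq⟩ : ActionOver q G) g₀) (𝔄₀ : NodeAtlasData p (GModel.initial hq h₀).act g₀) :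
    ∃ P : ∀ M : GModel p q G ρ g₀, NodeAtlasData p M.act g₀ → Prop,
      P (GModel.initial hq h₀) 𝔄₀ ∧ ∀ (M : GModel p q G ρ g₀) (𝔄 : NodeAtlasData p M.act g₀), P M 𝔄 → ¬ M.Terminal →
        ∃ n : ℕ, TreeF P (fun N 𝔅 => LexLTF N 𝔅 M 𝔄) n M 𝔄 :=
  exists_reachLowerF_of_killsIn_datum hp hG φ (GModel.initial hq h₀) 𝔄₀ (a1c2_killsIn_one hp hG hg₀ hq hreg φ σ hC h0 h1 h2 h3 e hστ h₀)

/-- **I-5e OF RECORD: the d4c3 datum satisfies the conclusion of `ReachLowerInF(X)`** at its initial model with ANY root decoration `𝔄₀`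
(`exists_reachLowerF_of_killsIn_datum` on `d4c3_killsIn_one`). [OURS · L1 W4.5c; NOT a statement of the manuscript] -/
theorem exists_reachLowerF_initial_of_d4c3 [Finite G] (hp : p.Prime) (hG : ∀ g : G, g ∈ Subgroup.zpowers g₀) (hg₀ : g₀ ^ p = 1)
    (hq : ∀ g : G, (ρ g).hom ≫ q = q) [IsIntegral X'] [IsLocallyNoetherian X'] [X'.IsSeparated] [IsAffine X'] [X₁.IsSeparated] [IsFinite q]
    (hreg : Scheme.IsRegular X') {k' : Type} [Field k'] (φ : X₁ ⟶ Spec (.of k')) [LocallyOfFiniteType φ]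
    {k : Type} [Field k] (σ : MvPolynomial (Fin 4) k ≃+* MvPolynomial (Fin 4) k) (hC : ∀ a : k, σ (C a) = C a)
    (h0 : σ (X 0) = X 0) (h1 : σ (X 1) = X 1 + X 0) (h2 : σ (X 2) = X 2 + X 0) (h3 : σ (X 3) = X 3 + (X 1 - X 2) ^ 3)
    (e : Γ(X', ⊤) ≃+* MvPolynomial (Fin 4) k)
    (hστ : ∀ t : Γ(X', ⊤), e ((ρ g₀⁻¹).hom.appLE ⊤ ⊤ (by rw [Scheme.Hom.preimage_top]) t) = σ (e t))
    (h₀ : NodeAtlas p (⟨ρ, hq⟩ : ActionOver q G) g₀) (𝔄₀ : NodeAtlasData p (GModel.initial hq h₀).act g₀) :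
    ∃ P : ∀ M : GModel p q G ρ g₀, NodeAtlasData p M.act g₀ → Prop,
      P (GModel.initial hq h₀) 𝔄₀ ∧ ∀ (M : GModel p q G ρ g₀) (𝔄 : NodeAtlasData p M.act g₀), P M 𝔄 → ¬ M.Terminal →
        ∃ n : ℕ, TreeF P (fun N 𝔅 => LexLTF N 𝔅 M 𝔄) n M 𝔄 :=
  exists_reachLowerF_of_killsIn_datum hp hG φ (GModel.initial hq h₀) 𝔄₀ (d4c3_killsIn_one hp hG hg₀ hq hreg φ σ hC h0 h1 h2 h3 e hστ h₀)

end Summit.ResolutionOfSingularities.ResolutionOfSingularities.Theorems.WildQuotientResolution.S1.GameFrame.GModel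

end
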